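import Summits.QuantumFields.BalabanUV.T4Continuum.Support.NE7CommutingAverageExp
import Summits.QuantumFields.BalabanUV.T4Continuum.Support.NE7LevelQFlatChain
import Summits.QuantumFields.BalabanUV.T4Continuum.Support.AbelianBlockAverage
import HarnessLib

/-!
# NE7CommutingConstraintHessian — IN THE U(1) (COMMUTING) SECTOR THE MULTI-LEVEL CONSTRAINT MAP IN THE CHART AT ANY SMALL BACKGROUND IS, NEAR `0`, THE FLAT LINEAR MAP `levelQ' L N j 1`;
# HENCE ITS SECOND DERIVATIVE VANISHES: `D²(levelQ L N j U ∘ chart_U)(0) = 0` — the MULTIPLIER TERM of the bordered Hessian (✓ `NE7MinActHessianHessForm`) DROPS OUT in the abelian sector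

Lineage `b2b-balaban-t4-ne7-p1` (CRUX PROVER NE7 #1 = OWNER of BINDER row NE7), generation 116 — brick 4b of ROAD-G116 §7 (G-ab).  By ✓ `NE7CommutingAverageExp.levelQ_vary_comm` the constraint map
along `U e^{ψ}` is `skewPR (res ((Tcoarse L)^[j+1] ψ))` as soon as the transported perturbation stays in the logarithmic ball at every level; the sup norm of `(Tcoarse L)^[m] ψ` is at most
`(2dL + L)^m·sup‖ψ‖` (✓ `SmoothRefineNeutral.norm_Tside_le`) and a loop sum costs a factor `2dL + 2L` (✓ `AbelianBlockAverage.norm_asum_loop_le`), so this holds for ALL `Φ` in a ball of the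
chart; and `skewPR (res ((Tcoarse L)^[j+1] Φ̃)) = levelQ' L N j 1 Φ` (✓ `NE7LevelQFlatChain.levelQ'_flatCfg_eq_skewPR_resDir`).  WHAT ([folklore]; 0 def, 0 sorry; `hcomm : ∀ a b, Commute a b`,
`L ≥ 1`, loop radii of `cavgIter L m U`, `m ≤ j`, at most `1/4`):
* `chart_eq_vary_one`, `norm_chartDir_le`, `norm_iterate_Tcoarse_le` (sup bound `(2dL+L)^m`);
* **`levelQ_chart_eventuallyEq_flat`**: `(Φ ↦ levelQ L N j U (chart_U Φ)) =ᶠ[𝓝 0] (Φ ↦ levelQ' L N j 1 Φ)` on `skewSub d n (L·tower L N j)`;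
* **`fderiv_fderiv_levelQ_chart_eq_zero`**: `fderiv ℝ (fderiv ℝ (Φ ↦ levelQ L N j U (chart_U Φ))) 0 = 0`, and `… 0 X X = 0` for every `X`.
HONEST FRAMING: kinematics under an explicit commutation HYPOTHESIS; the background's multi-level loop smallness is a binder (discharged for class minimisers in the sequel); nothing
about Bałaban's minimisers here; NOT NE7 as a spine node; spine 0∕9; NOT infinite volume, NOT mass gap, NOT BetaPertH, NOT Clay.
-/

set_option autoImplicit false

open scoped BigOperators Matrix Matrix.Norms.L2Operator Topology
open NormedSpace Finset Filter

namespace Summit.QuantumFields.BalabanUV.T4Continuum.NE7CommutingConstraintHessian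

open Literature.MathematicalPhysics.QuantumFieldTheory.Balaban1983to89
open B7Prop1Explicit B7Prop2Explicit MatrixLog
open T4AveragingDeficitWall (vary)
open AveragingDeficitTorusChart (TDir chart chartDir resDir redN)
open AveragingDeficitChartCalculus (coord cavg)
open AveragingDeficitTwoLevelPrep (skewSub skewPR)
open AveragingDeficitMultiLevelPrep (tower levelQ levelQ' cavgIter tower_ne_zero)
open MinimalActionWitness (flatCfg)
open SmoothRefineNeutral (Tcoarse norm_Tside_le)
open AbelianBlockAverage (norm_asum_loop_le)
open NE7CommutingAverageExp (levelQ_vary_comm)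
open NE7LevelQFlatChain (levelQ'_flatCfg_eq_skewPR_resDir)

noncomputable section

variable {d : ℕ} {n : Type} [Fintype n] [DecidableEq n]

/-! ## §1 The chart is a unit-time multiplicative variation; sup bounds through the tower -/

/-- `chart_V Φ = V e^{1·Φ̃}`: the chart at `V` is the variation `vary V (chartDir Φ) 1`. [folklore] -/
theorem chart_eq_vary_one (N : ℕ) [NeZero N] (V : Site d → Fin d → (Matrix n n ℂ)ˣ) (Φ : TDir d n N) :
    chart (ContinuousLinearMap.id ℝ (Matrix n n ℂ)) N V Φ = vary V (chartDir (ContinuousLinearMap.id ℝ (Matrix n n ℂ)) N Φ) 1 := by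
  funext x κ
  simp only [chart, vary, Complex.ofReal_one, one_smul]

/-- The periodic extension is bounded by the sup norm of the torus datum: `‖Φ̃ x κ‖ ≤ ‖Φ‖`. [folklore] -/
theorem norm_chartDir_le (N : ℕ) [NeZero N] (Φ : TDir d n N) (x : Site d) (κ : Fin d) :
    ‖chartDir (ContinuousLinearMap.id ℝ (Matrix n n ℂ)) N Φ x κ‖ ≤ ‖Φ‖ := by
  simp only [chartDir, ContinuousLinearMap.coe_id', id]
  exact (norm_le_pi_norm (Φ (redN N x)) κ).trans (norm_le_pi_norm Φ (redN N x))

/-- **Sup bound through the tower**: `‖(Tcoarse L)^[m] A y μ‖ ≤ (2dL + L)^m · a` from `‖A‖ ≤ a` (`L ≥ 1`). [folklore] -/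
theorem norm_iterate_Tcoarse_le {L : ℕ} (hL : 1 ≤ L) :
    ∀ (m : ℕ) (A : Site d → Fin d → Matrix n n ℂ) {a : ℝ}, 0 ≤ a → (∀ y μ, ‖A y μ‖ ≤ a) →
      ∀ (y : Site d) (μ : Fin d), ‖(Tcoarse L)^[m] A y μ‖ ≤ (2 * ((d : ℝ) * L) + L) ^ m * a
  | 0, A, a, _, hA, y, μ => by simpa using hA y μ
  | m + 1, A, a, ha, hA, y, μ => by
      rw [Function.iterate_succ_apply', pow_succ, mul_assoc, mul_comm ((2 * ((d : ℝ) * L) + L)) a, ← mul_assoc]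
      have ih := norm_iterate_Tcoarse_le hL m A ha hA
      have hKa : 0 ≤ (2 * ((d : ℝ) * L) + L) ^ m * a := by positivity
      have h := norm_Tside_le hL ((Tcoarse L)^[m] A) hKa ih ((L : ℤ) • y) μ
      simpa [Tcoarse, mul_comm, mul_assoc, mul_left_comm] using h

/-! ## §2 The constraint map in the chart is the flat linear map near `0` -/

section Comm

variable (hcomm : ∀ a b : Matrix n n ℂ, Commute a b)
include hcomm

/-- **NEAR `0` THE CONSTRAINT MAP IN THE CHART AT `U` IS THE FLAT DIFFERENTIAL** (commuting sector; `L ≥ 1`; loop radii of the averaged backgrounds `cavgIter L m U`, `m ≤ j`, at most `1/4`).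
[folklore] -/
theorem levelQ_chart_eventuallyEq_flat {L N : ℕ} [NeZero L] [NeZero N] (hL : 1 ≤ L) (j : ℕ) (U : Site d → Fin d → (Matrix n n ℂ)ˣ)
    (hW : ∀ m ≤ j, ∀ (y : Site d) (κ : Fin d) (r : Fin d → Fin L),
        ‖((Wcx L (cavgIter L m U) ((L : ℤ) • y) κ (boxVec L r) : (Matrix n n ℂ)ˣ) : Matrix n n ℂ) - 1‖ ≤ 1 / 4) :
    (fun Φ : ↥(skewSub d n (L * tower L N j)) =>
        levelQ L N j U (chart (ContinuousLinearMap.id ℝ (Matrix n n ℂ)) (L * tower L N j) U (Φ : TDir d n (L * tower L N j))))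
      =ᶠ[𝓝 0] fun Φ => levelQ' L N j (flatCfg : Site d → Fin d → (Matrix n n ℂ)ˣ) (Φ : TDir d n (L * tower L N j)) := by
  haveI : NeZero (L * tower L N j) := ⟨Nat.mul_ne_zero (NeZero.ne L) (tower_ne_zero L N j)⟩
  -- the constants
  set K : ℝ := 2 * ((d : ℝ) * L) + L with hK
  set C : ℝ := ((2 * (d * L) + L + L : ℕ) : ℝ) + 1 with hC
  have hL1 : (1 : ℝ) ≤ L := by exact_mod_cast hL
  have hK1 : 1 ≤ K := by rw [hK]; nlinarith [show (0 : ℝ) ≤ (d : ℝ) * L by positivity]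
  have hC1 : 1 ≤ C := by
    have h0 : (0 : ℝ) ≤ ((2 * (d * L) + L + L : ℕ) : ℝ) := by positivity
    rw [hC]; linarith
  have hlog : (1 : ℝ) / 2 < Real.log 2 := by have := Real.log_two_gt_d9; linarith
  set δ : ℝ := (Real.log 2 - 1 / 2) / (C * K ^ (j + 1)) with hδ
  have hden : 0 < C * K ^ (j + 1) := by positivity
  have hδ0 : 0 < δ := div_pos (by linarith) hden
  -- on the ball of radius `δ` the hypotheses of `levelQ_vary_comm` hold
  filter_upwards [Metric.ball_mem_nhds (0 : ↥(skewSub d n (L * tower L N j))) hδ0] with Φ hΦ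
  rw [Metric.mem_ball, dist_zero_right] at hΦ
  set A : Site d → Fin d → Matrix n n ℂ := chartDir (ContinuousLinearMap.id ℝ (Matrix n n ℂ)) (L * tower L N j) (Φ : TDir d n (L * tower L N j)) with hA
  have hA0 : ∀ y μ, ‖A y μ‖ ≤ ‖Φ‖ := fun y μ => norm_chartDir_le _ _ y μ
  have hsup : ∀ (m : ℕ) (y : Site d) (μ : Fin d), ‖(Tcoarse L)^[m] A y μ‖ ≤ K ^ m * ‖Φ‖ := fun m => norm_iterate_Tcoarse_le hL m A (norm_nonneg _) hA0
  have hpow : ∀ m ≤ j + 1, K ^ m * ‖Φ‖ ≤ K ^ (j + 1) * ‖Φ‖ := fun m hm =>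
    mul_le_mul_of_nonneg_right (pow_le_pow_right₀ hK1 hm) (norm_nonneg _)
  have hmain : C * (K ^ (j + 1) * ‖Φ‖) < Real.log 2 - 1 / 2 := by
    have : ‖Φ‖ * (C * K ^ (j + 1)) < Real.log 2 - 1 / 2 := (lt_div_iff₀ hden).mp hΦ
    linarith
  have hs : ∀ m ≤ j, ∀ (y : Site d) (κ : Fin d) (r : Fin d → Fin L),
      ‖((1 : ℝ) : ℂ) • asum ((Tcoarse L)^[m] A) ((L : ℤ) • y) (gammaWord L κ (boxVec L r) ++ seg κ (-(L : ℤ)))‖ < Real.log 2 - 1 / 2 := by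
    intro m hm y κ r
    rw [Complex.ofReal_one, one_smul]
    have h1 := norm_asum_loop_le L ((Tcoarse L)^[m] A) ((L : ℤ) • y) κ (a := K ^ m * ‖Φ‖) (by positivity) (fun x μ _ => hsup m x μ) r
    have h2 : ((2 * (d * L) + L + L : ℕ) : ℝ) * (K ^ m * ‖Φ‖) ≤ C * (K ^ (j + 1) * ‖Φ‖) :=
      mul_le_mul (by rw [hC]; linarith) (hpow m (by omega)) (by positivity) (by positivity)
    linarith
  have htop : ∀ (r : Fin d → Fin N) (κ : Fin d), ‖((1 : ℝ) : ℂ) • (Tcoarse L)^[j + 1] A (boxVec N r) κ‖ < Real.log 2 := by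
    intro r κ
    rw [Complex.ofReal_one, one_smul]
    have h1 := hsup (j + 1) (boxVec N r) κ
    have h2 : K ^ (j + 1) * ‖Φ‖ ≤ C * (K ^ (j + 1) * ‖Φ‖) := le_mul_of_one_le_left (by positivity) hC1
    linarith
  -- conclude
  show levelQ L N j U (chart (ContinuousLinearMap.id ℝ (Matrix n n ℂ)) (L * tower L N j) U (Φ : TDir d n (L * tower L N j)))
      = levelQ' L N j (flatCfg : Site d → Fin d → (Matrix n n ℂ)ˣ) (Φ : TDir d n (L * tower L N j))
  rw [chart_eq_vary_one, levelQ_vary_comm hcomm hL N j U A 1 hW hs htop, levelQ'_flatCfg_eq_skewPR_resDir j Φ.2]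
  congr 1
  funext r κ
  rw [Complex.ofReal_one, one_smul]
  rfl

/-- **THE SECOND DERIVATIVE OF THE CONSTRAINT MAP IN THE CHART VANISHES** in the commuting sector (the multiplier term of the bordered Hessian drops out). [folklore] -/
theorem fderiv_fderiv_levelQ_chart_eq_zero {L N : ℕ} [NeZero L] [NeZero N] (hL : 1 ≤ L) (j : ℕ) (U : Site d → Fin d → (Matrix n n ℂ)ˣ)
    (hW : ∀ m ≤ j, ∀ (y : Site d) (κ : Fin d) (r : Fin d → Fin L),
        ‖((Wcx L (cavgIter L m U) ((L : ℤ) • y) κ (boxVec L r) : (Matrix n n ℂ)ˣ) : Matrix n n ℂ) - 1‖ ≤ 1 / 4) :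
    fderiv ℝ (fderiv ℝ (fun Φ : ↥(skewSub d n (L * tower L N j)) =>
        levelQ L N j U (chart (ContinuousLinearMap.id ℝ (Matrix n n ℂ)) (L * tower L N j) U (Φ : TDir d n (L * tower L N j))))) 0 = 0 := by
  haveI : NeZero (L * tower L N j) := ⟨Nat.mul_ne_zero (NeZero.ne L) (tower_ne_zero L N j)⟩
  set Λ : ↥(skewSub d n (L * tower L N j)) →L[ℝ] ↥(skewSub d n N) :=
    (levelQ' L N j (flatCfg : Site d → Fin d → (Matrix n n ℂ)ˣ)).comp (skewSub d n (L * tower L N j)).subtypeL with hΛ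
  have hev := levelQ_chart_eventuallyEq_flat hcomm hL j U hW (N := N)
  have hev' : (fun Φ : ↥(skewSub d n (L * tower L N j)) =>
        levelQ L N j U (chart (ContinuousLinearMap.id ℝ (Matrix n n ℂ)) (L * tower L N j) U (Φ : TDir d n (L * tower L N j))))
      =ᶠ[𝓝 0] (Λ : ↥(skewSub d n (L * tower L N j)) → ↥(skewSub d n N)) :=
    hev.mono fun Φ hΦ => by rw [hΦ]; rfl
  have hD : fderiv ℝ (fun Φ : ↥(skewSub d n (L * tower L N j)) =>
        levelQ L N j U (chart (ContinuousLinearMap.id ℝ (Matrix n n ℂ)) (L * tower L N j) U (Φ : TDir d n (L * tower L N j))))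
      =ᶠ[𝓝 0] fun _ => Λ :=
    hev'.eventuallyEq_nhds.mono fun Φ hΦ => by rw [hΦ.fderiv_eq, ContinuousLinearMap.fderiv]
  rw [hD.fderiv_eq, fderiv_const_apply]

/-- The same, evaluated: `D²(levelQ L N j U ∘ chart_U)(0)[X, X] = 0` for every direction `X`. [folklore] -/
theorem fderiv_fderiv_levelQ_chart_apply_eq_zero {L N : ℕ} [NeZero L] [NeZero N] (hL : 1 ≤ L) (j : ℕ) (U : Site d → Fin d → (Matrix n n ℂ)ˣ)
    (hW : ∀ m ≤ j, ∀ (y : Site d) (κ : Fin d) (r : Fin d → Fin L),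
        ‖((Wcx L (cavgIter L m U) ((L : ℤ) • y) κ (boxVec L r) : (Matrix n n ℂ)ˣ) : Matrix n n ℂ) - 1‖ ≤ 1 / 4)
    (X : ↥(skewSub d n (L * tower L N j))) :
    fderiv ℝ (fderiv ℝ (fun Φ : ↥(skewSub d n (L * tower L N j)) =>
        levelQ L N j U (chart (ContinuousLinearMap.id ℝ (Matrix n n ℂ)) (L * tower L N j) U (Φ : TDir d n (L * tower L N j))))) 0 X X = 0 := by
  rw [fderiv_fderiv_levelQ_chart_eq_zero hcomm hL j U hW]
  rfl

end Comm

end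

end Summit.QuantumFields.BalabanUV.T4Continuum.NE7CommutingConstraintHessian
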